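import Summits.BirchSwinnertonDyer.Rank2.LambdaDoorKernelAtTwo
import HarnessLib

/-!
# The `2`-Selmer group is CONSTANT on the `χ₈`-floor door (Mazur–Rubin silent primes)

Companion to `MatsunoBridgeAtTwo.lean` (p2 GEN 43, cell bsd-rank2).  The Matsuno bridge gives, on the
door class `A ≅ E₀^{(d)}` (`d > 0` squarefree, `d ≡ 1 (4)`, `(d, N₀) = 1`, every `ℓ ∣ d` with
`#Ẽ₀(𝔽_ℓ)` odd), the `2`-adic identity `corank Sel_{2^∞}(A/ℚ) = ord_T L₂(A) ∈ {0, 2}` modulo print and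
two analytic inputs (`hS`, the eighth-cusp floor of the twist, needed only in the `= 2` branch; and
`μ(X₂(E₀)) = 0`).  This file records the ALGEBRAIC half of the picture, which needs no `L`-function:

* PRINT `mazurRubin2010_selmerGroup_two_quadraticTwist_silent` — B. Mazur, K. Rubin, *Ranks of
  twists of elliptic curves and Hilbert's tenth problem*, Invent. Math. 181 (2010) 541–575
  (arXiv:0904.3709), **Proposition 3.3 / Corollary 3.4 (ii)** with `K = ℚ`, `F = ℚ(√d)`:
  «Suppose that all primes of additive reduction, all multiplicative `v` with `ord_v(Δ_E)` even, all
  primes above `2` and all real places with `(Δ_E)_v > 0` split in `F/K`, and all multiplicative `v`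
  with `ord_v(Δ_E)` odd are unramified in `F/K`; let `T` be the set of primes where `F/K` is ramified.
  (ii) If `E(K_𝔭)[2] = 0` for every `𝔭 ∈ T`, then `d₂(E^F/K) = d₂(E/K)`.»  (Mechanism, op. cit.
  Remark 2.4, Lemmas 2.10–2.11: `E[2] = E^F[2]` canonically, both Selmer groups live in
  `H¹(K, E[2])`; at a split place the local conditions coincide because `E ≅ E^F` locally; at a
  ramified good prime `𝔭` with `E(K_𝔭)[2] = 0` one has `H¹(K_𝔭, E[2]) = 0` by the local Euler
  characteristic, so there is no condition at all.)  Typed in the DOOR SPECIAL CASE that makes every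
  bad place split: `d ≡ 1 (mod 8)` (so `2` and `∞` split and `d ∈ (ℚ₂ˣ)²`), `d` a nonzero square
  modulo every odd bad prime, `d` coprime to the conductor, and every prime `ℓ ∣ d` SILENT:
  `#Ẽ(𝔽_ℓ)` odd (equivalently `Frob_ℓ` acts on `E[2]` as a `3`-cycle, equivalently `a_ℓ` odd).
  For a base of PRIME conductor `N₀` and a prime `d = q ≡ 1 (mod 8)` the square condition is
  `χ_q(N₀) = +1`, i.e. exactly the door (and it is vacuous when `ord_{N₀}(Δ₀)` is odd).
* COROLLARIES (§2): on the door the order of `Sel₂` is that of the base — for the cell's rank-`2`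
  bases (`#Sel₂(E₀) = 4`, no `2`-torsion, `Ш(E₀)[2] = 0`) every door twist has `#Sel₂(A/ℚ) = 4`
  in BOTH branches of the dichotomy; applied to (a minimal model of) `E₀^{(2)}` (`Sel₂ = 0`,
  jobI: rank `0`, `Ш_an = 1`) every `E₀^{(2q)}` has `Sel₂ = 0`, hence rank `0` and `Ш[2] = 0`,
  unconditionally.
* READING (docstrings only; B1-honest): in the `0`-branch (`L(A,1) ≠ 0`, rank `A = 0` by Kato) the
  four Selmer classes are VISIBLE Ш: `Ш(A)[2] ≅ (ℤ/2)²` (numerics jobJ: `v₂(Ш_an) ∈ {2, 4}`, 39/39);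
  in the `= 2` branch `#Sel₂(A) = 4` is consistent with, but does not prove, `corank = 2` (the
  alternative `rank 0 ∧ Ш(A)[2^∞] ⊇ (ℤ/2)² finite` is what the analytic input `hS` excludes); and the
  `= 2`-branch input `hS` is EQUIVALENT (jobG/jobI normalisation) to the `2`-part of BSD for the
  `Sel₂`-trivial rank-`0` curve `E₀^{(2q)}`: `v₂(L(E₀^{(2q)},1)/Ω) = v₂(∏ c_ℓ(E₀^{(2q)})) = 2`.
Numerics (kit j328370, jobJ, 10 bases, door `q < 160`): `dim Sel₂(E₀^{(q)}) = 2` in 58/58 door cases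
(`q ≡ 1` and `5 (mod 8)`, both branches); with jobC2 (`= 2` branch, `q < 1200`): 70/70.

## References
* B. Mazur, K. Rubin, Invent. Math. 181 (2010) 541–575, Rem. 2.4, Lemma 2.10, Lemma 2.11, Prop. 3.3,
  Cor. 3.4. arXiv:0904.3709. [MazurRubin2010]
* D. Kriz, C. Li, Forum Math. Sigma 7 (2019) e15, Def. 4.1 (silent primes `S`), Thm. 4.3. [KrizLi2019]
-/

set_option autoImplicit false

noncomputable section

open scoped Classical
open WeierstrassCurve Literature.NumberTheory.EllipticCurves

namespace Summit.BirchSwinnertonDyer.Rank2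

/-! ### §1. The named fact (Mazur–Rubin 2010, Cor. 3.4 (ii), door special case over `ℚ`) -/

/-- **Mazur–Rubin 2010, Proposition 3.3 / Corollary 3.4 (ii)** (`K = ℚ`, `F = ℚ(√d)`), door special
case: for a globally minimal `W/ℚ` and a squarefree `d > 0` with `d ≡ 1 (mod 8)`, `d` coprime to the
conductor, `d` a square modulo every odd prime of bad reduction, and every prime `ℓ ∣ d` silent
(`#W̃(𝔽_ℓ)` odd, i.e. `W(ℚ_ℓ)[2] = 0`), the `2`-Selmer groups of `W` and of (any globally minimal model
`A` of) the twist `W^{(d)}` have the same order — in print they are literally the same subgroup of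
`H¹(ℚ, W[2])`.  «If `E(K_𝔭)[2] = 0` for every `𝔭 ∈ T`, then `d₂(E^F/K) = d₂(E/K)`.»
[cite: MazurRubin2010, Cor. 3.4 (ii); Prop. 3.3; Lemma 2.10; Lemma 2.11] -/
def mazurRubin2010_selmerGroup_two_quadraticTwist_silent : Prop :=
  ∀ (W A : WeierstrassCurve ℚ) [W.IsElliptic] [W.IsGloballyMinimal] [A.IsElliptic]
    [A.IsGloballyMinimal] (d : ℕ), 0 < d → Squarefree d → d % 8 = 1 →
    Nat.Coprime d (W.conductorNorm ℤ) →
    (∀ p : ℕ, p.Prime → p ≠ 2 → p ∣ W.conductorNorm ℤ → IsSquare ((d : ZMod p))) →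
    (∀ ℓ ∈ d.primeFactors, ¬ 2 ∣ W.reductionPointCount ℓ) →
    (∃ C : VariableChange ℚ, C • W.quadraticTwist (d : ℚ) = A) →
    Nat.card (A.selmerGroup 2) = Nat.card (W.selmerGroup 2)

/-! ### §2. Corollaries on the door -/

variable {W₀ A : WeierstrassCurve ℚ} [W₀.IsElliptic] [W₀.IsGloballyMinimal] [A.IsElliptic]
  [A.IsGloballyMinimal]

/-- **`Sel₂` is constant on the silent door (squarefree `d ≡ 1 (mod 8)`).**  Direct reading of the
named fact: `#Sel₂(A/ℚ) = #Sel₂(W₀/ℚ)` for every globally minimal model `A` of `W₀^{(d)}`.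
[cite: MazurRubin2010, Cor. 3.4 (ii)] -/
theorem card_selmerGroup_two_eq_of_silentDoor
    (hMR : mazurRubin2010_selmerGroup_two_quadraticTwist_silent)
    {d : ℕ} (hd0 : 0 < d) (hsq : Squarefree d) (hd8 : d % 8 = 1)
    (hdN : Nat.Coprime d (W₀.conductorNorm ℤ))
    (hsqN : ∀ p : ℕ, p.Prime → p ≠ 2 → p ∣ W₀.conductorNorm ℤ → IsSquare ((d : ZMod p)))
    (hodd : ∀ ℓ ∈ d.primeFactors, ¬ 2 ∣ W₀.reductionPointCount ℓ)
    (hA : ∃ C : VariableChange ℚ, C • W₀.quadraticTwist (d : ℚ) = A) :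
    Nat.card (A.selmerGroup 2) = Nat.card (W₀.selmerGroup 2) :=
  hMR W₀ A d hd0 hsq hd8 hdN hsqN hodd hA

/-- **Prime door, `q ≡ 1 (mod 8)`.**  For a silent door prime `q` (`#W̃₀(𝔽_q)` odd, `q ∤ N₀`,
`q` a square modulo every odd bad prime — for prime `N₀` this is `χ_q(N₀) = +1` by reciprocity):
`#Sel₂(A/ℚ) = #Sel₂(W₀/ℚ)` for `A ≅ W₀^{(q)}`.  This is the companion of
`twoAdicBSD_corank_dichotomy_of_matsunoBridge_primeDoor` (`MatsunoBridgeAtTwo.lean` §8): the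
`2^∞`-corank is `0` or `2` according to `L(A,1)`, while `#Sel₂` does not move at all.
[cite: MazurRubin2010, Cor. 3.4 (ii)] -/
theorem card_selmerGroup_two_eq_of_silentPrimeDoor
    (hMR : mazurRubin2010_selmerGroup_two_quadraticTwist_silent)
    {q : ℕ} (hq : q.Prime) (hq8 : q % 8 = 1) (hqN : ¬ q ∣ W₀.conductorNorm ℤ)
    (hsqN : ∀ p : ℕ, p.Prime → p ≠ 2 → p ∣ W₀.conductorNorm ℤ → IsSquare ((q : ZMod p)))
    (hoddq : ¬ 2 ∣ W₀.reductionPointCount q)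
    (hA : ∃ C : VariableChange ℚ, C • W₀.quadraticTwist (q : ℚ) = A) :
    Nat.card (A.selmerGroup 2) = Nat.card (W₀.selmerGroup 2) := by
  refine card_selmerGroup_two_eq_of_silentDoor hMR hq.pos hq.squarefree hq8
    ((Nat.Prime.coprime_iff_not_dvd hq).mpr hqN) hsqN ?_ hA
  intro ℓ hℓ
  rw [hq.primeFactors, Finset.mem_singleton] at hℓ
  subst hℓ
  exact hoddq

/-- **The rank-`2` bases: `#Sel₂ = 4` along the whole silent door.**  If the base has `#Sel₂(W₀/ℚ) = 4`
(the cell's bases: rank `2`, `W₀(ℚ)[2] = 0`, `Ш(W₀)[2] = 0`), then so does every door twist — in the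
`0`-branch of the dichotomy (rank `A = 0`) these four classes are `Ш(A)[2] ≅ (ℤ/2)²` (visible Ш;
jobJ: `v₂(Ш_an(A)) ∈ {2,4}` in 39/39 cases), in the `= 2` branch they are `A(ℚ)/2A(ℚ)` as soon as
`Ш(A)[2^∞]` is finite.  B1: nothing here separates the two branches — that is what the analytic input
`hS` of the bridge does. [cite: MazurRubin2010, Cor. 3.4 (ii)] -/
theorem card_selmerGroup_two_eq_four_of_silentDoor
    (hMR : mazurRubin2010_selmerGroup_two_quadraticTwist_silent)
    (h4 : Nat.card (W₀.selmerGroup 2) = 4)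
    {d : ℕ} (hd0 : 0 < d) (hsq : Squarefree d) (hd8 : d % 8 = 1)
    (hdN : Nat.Coprime d (W₀.conductorNorm ℤ))
    (hsqN : ∀ p : ℕ, p.Prime → p ≠ 2 → p ∣ W₀.conductorNorm ℤ → IsSquare ((d : ZMod p)))
    (hodd : ∀ ℓ ∈ d.primeFactors, ¬ 2 ∣ W₀.reductionPointCount ℓ)
    (hA : ∃ C : VariableChange ℚ, C • W₀.quadraticTwist (d : ℚ) = A) :
    Nat.card (A.selmerGroup 2) = 4 :=
  (card_selmerGroup_two_eq_of_silentDoor hMR hd0 hsq hd8 hdN hsqN hodd hA).trans h4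

/-- **The `2`-twisted base: `Sel₂ = 0` along the whole silent door.**  Applied to a globally minimal
model `W₂` of `E₀^{(2)}` with `#Sel₂(W₂/ℚ) = 1` (jobI: `E₀^{(2)}` has rank `0`, `Ш_an = 1`, no
`2`-torsion for all ten bases), every `A' ≅ W₂^{(d)} ≅ E₀^{(2d)}` on the silent door has
`#Sel₂(A'/ℚ) = 1`: rank `0` and `Ш(A')[2] = 0` with no `L`-function in sight.  Under BSD this says
`v₂(L(E₀^{(2d)},1)/Ω) = v₂(∏ c_ℓ)` (`= 2` on the door, jobI 40/40), which in the `= 2` branch is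
exactly the bridge's analytic input `hS` (REGIMES-AB.md §7). [cite: MazurRubin2010, Cor. 3.4 (ii)] -/
theorem card_selmerGroup_two_eq_one_of_silentDoor {W₂ A' : WeierstrassCurve ℚ} [W₂.IsElliptic]
    [W₂.IsGloballyMinimal] [A'.IsElliptic] [A'.IsGloballyMinimal]
    (hMR : mazurRubin2010_selmerGroup_two_quadraticTwist_silent)
    (h1 : Nat.card (W₂.selmerGroup 2) = 1)
    {d : ℕ} (hd0 : 0 < d) (hsq : Squarefree d) (hd8 : d % 8 = 1)
    (hdN : Nat.Coprime d (W₂.conductorNorm ℤ))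
    (hsqN : ∀ p : ℕ, p.Prime → p ≠ 2 → p ∣ W₂.conductorNorm ℤ → IsSquare ((d : ZMod p)))
    (hodd : ∀ ℓ ∈ d.primeFactors, ¬ 2 ∣ W₂.reductionPointCount ℓ)
    (hA : ∃ C : VariableChange ℚ, C • W₂.quadraticTwist (d : ℚ) = A') :
    Nat.card (A'.selmerGroup 2) = 1 :=
  (hMR W₂ A' d hd0 hsq hd8 hdN hsqN hodd hA).trans h1

end Summit.BirchSwinnertonDyer.Rank2
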